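import Summits.QuantumAdvantage.QuantumAdvantage.Theorems.ArithStatLadderIqThreeNotBPPStubOrQueryFP
import Summits.QuantumAdvantage.QuantumAdvantage.Theorems.ArithStatLadderIqThreeNotBPPStubOrVerdictP
import Summits.QuantumAdvantage.QuantumAdvantage.Theorems.ArithStatLadderIqThreeNotBPPStubBlockMissProb
import Summits.QuantumAdvantage.QuantumAdvantage.Theorems.ArithStatLadderIqThreeNotBPPStubExpQuarter
import Literature.Computability.Complexity.AdaptiveBPPSimulation
import Literature.Computability.Complexity.BPPTruthTableClosure
import Literature.Computability.MetaComplexity.RandReductionsBPPProofs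

/-!
# Crux `ArithStatLadder.IqThreeNotBPP` (stmt-QuantumAdvantage-14864): `BPP` is closed under one-sided randomized reductions

Glue of the line `Sketch` (UNIFORM SQUAREFREE-FILTER DOMINATION), complexity half — the uniform twin
of `mem_PPoly_of_rurReduction` (`…IqThreeNotPPolyRURClosure.lean`, crux 2422): **`BPP` is closed
downwards under one-sided randomized (RUR-type) polynomial-time many-one reductions with success
probability only `≥ 1/q(n)` from some length `n₀` on** (`mem_BPP_of_rurReduction`). If `f ∈ FP`,
every NO-instance `x ∉ L₁` is mapped OUTSIDE `L₂` for every seed (`f ⟨x, r⟩ ∉ L₂`), every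
YES-instance `x ∈ L₁` of length `n ≥ n₀` is mapped INTO `L₂` for at least a `1/q(n)` fraction of the
seeds `r ∈ {0,1}^{ℓ(n)}` (`ℓ` a polynomial), and `L₂ ∈ BPP`, then `L₁ ∈ BPP`.

Proof (no machine is written; four landed stubs + three tree theorems): the language `L₃` — "the
guard `n₀ ≤ |x|` holds and one of the first `2q(|w|)` seed blocks of `R` maps `x` into `L₂`",
`w = ⟨x, R⟩` — is a bounded adaptive reduction to `L₂` (query generator `stub_orQueryFP ∈ FP`, verdict
`stub_orVerdictP ∈ P`), hence in `BPP` by `AdBPPSim.adLang_mem_BPP` (`P^BPP = BPP`); the block sampler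
`x ↦ ⟨x, R⟩`, `|R| = 2q(n)ℓ(n)` coins exactly, is a randomized reduction of `L₁ ∩ {n₀ ≤ |x|}` to `L₃`
that is correct with probability `1` on NO-instances (exactness) and `≥ 1 − (1 − 1/q)^{2q} ≥ 3/4` on
YES-instances (product rule for fresh blocks `stub_blockMissProb`, `stub_expQuarter`), so
`L₁ ∩ {n₀ ≤ |x|} ∈ BPP` by the corrected Arora–Barak §7.6 remark
`mem_BPP_of_polyTimeRandReducible'_holds`, and `L₁ ∈ BPP` by the finite-variation splice
`mem_BPP_of_eqOn_le`. References: D. Micciancio, SIAM J. Comput. 30 (2001), §2 (RUR reductions);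
S. Arora, B. Barak, *Computational Complexity*, CUP 2009, §7.4.1, §7.6; K.-I Ko, IPL 14 (1982)
(`BPP^BPP = BPP`). Theorems only; sorry-free.
-/

set_option linter.dupNamespace false -- D-0017: single-problem summit ⇒ `QuantumAdvantage.QuantumAdvantage` by design

noncomputable section

namespace Summit.QuantumAdvantage.QuantumAdvantage.Theorems.IqThreeNotBPP

open scoped Classical
open _root_.Computability Polynomial Finset
open Literature.Computability.Complexity
open Literature.Computability.Complexity.Brick (fstF sndF fstF_boolPair sndF_boolPair)
open Literature.Computability.MetaComplexity (PolyTimeRandReducible' mem_BPP_of_polyTimeRandReducible'_holds)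

/-! ### The answer string of a round-indexed query generator -/

/-- The answer string of an adaptive reduction whose queries depend only on the ROUND (the length of
the answers received so far) is the list of the indicator bits of the queries. [folklore] -/
theorem adBits_eq_map_range {Qg : List Bool → List Bool} {A : Language Bool} {w : List Bool}
    (Qfun : ℕ → List Bool) (hQ : ∀ acc : List Bool, Qg (boolPair w acc) = Qfun acc.length) :
    ∀ k, AdQuery.adBits Qg A w k = (List.range k).map (fun i => A.boolIndicator (Qfun i))
  | 0 => rfl
  | k + 1 => by
    rw [AdQuery.adBits_succ, hQ, AdQuery.length_adBits, adBits_eq_map_range Qfun hQ k,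
      List.range_succ, List.map_append, List.map_singleton]

/-- `1 ∈` the answer string iff some query of a round `< k` is in `A`. [folklore] -/
theorem true_mem_adBits_iff {Qg : List Bool → List Bool} {A : Language Bool} {w : List Bool}
    (Qfun : ℕ → List Bool) (hQ : ∀ acc : List Bool, Qg (boolPair w acc) = Qfun acc.length) (k : ℕ) :
    true ∈ AdQuery.adBits Qg A w k ↔ ∃ i < k, Qfun i ∈ A := by
  rw [adBits_eq_map_range Qfun hQ k, List.mem_map]
  constructor
  · rintro ⟨i, hi, h⟩
    refine ⟨i, List.mem_range.1 hi, ?_⟩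
    by_contra hni
    rw [(Set.notMem_iff_boolIndicator _ _).1 hni] at h
    exact Bool.false_ne_true h
  · rintro ⟨i, hi, h⟩
    exact ⟨i, List.mem_range.2 hi, (Set.mem_iff_boolIndicator _ _).1 h⟩

/-! ### The closure theorem -/

/-- **`BPP` is closed downwards under one-sided randomized polynomial-time many-one reductions with
success probability `≥ 1/q(n)` for `n ≥ n₀`** (the uniform twin of the landed
`mem_PPoly_of_rurReduction`; RUR reductions in the sense of Micciancio 2001, §2). Data: `f ∈ FP`
reading `⟨x, r⟩ = boolPair x r`; seed length `ℓ(n)`, a polynomial (`ℓ = ℓp`); NO side exact for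
every seed; YES side: `2^{ℓ(n)} ≤ q(n) · #{r ∈ {0,1}^{ℓ(n)} : f ⟨x, r⟩ ∈ L₂}` for `x ∈ L₁`,
`|x| = n ≥ n₀`. Proof: the language `L₃` "some of the first `2q(|w|)` seed blocks of `R` maps `x`
into `L₂`" (`w = ⟨x, R⟩`, plus the guard `n₀ ≤ |x|`) is a bounded adaptive reduction to `L₂`, hence
in `BPP` (`AdBPPSim.adLang_mem_BPP`); `x ↦ ⟨x, R⟩` with `2q(n)ℓ(n)` coins is a randomized reduction of
`L₁ ∩ {n₀ ≤ |x|}` to `L₃` correct with probability `1` on NO-instances (exactness) and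
`≥ 1 − (1 − 1/q)^{2q} ≥ 3/4` on YES-instances (fresh blocks, `stub_blockMissProb`,
`stub_expQuarter`), so `L₁ ∩ {n₀ ≤ |x|} ∈ BPP` (`mem_BPP_of_polyTimeRandReducible'_holds`), and
`L₁ ∈ BPP` by the finite-variation splice `mem_BPP_of_eqOn_le`. [cite: AroraBarakCC2009, §7.6 and §7.4.1] -/
theorem mem_BPP_of_rurReduction (L₁ L₂ : Language Bool) (f : List Bool → List Bool) (hf : f ∈ FP)
    (ℓ : ℕ → ℕ) (ℓp q : Polynomial ℕ) (n₀ : ℕ) (hℓ : ∀ n, ℓ n = ℓp.eval n)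
    (hNO : ∀ x : List Bool, x ∉ L₁ → ∀ r : List Bool, f (boolPair x r) ∉ L₂)
    (hYES : ∀ x : List Bool, x ∈ L₁ → n₀ ≤ x.length →
      2 ^ (ℓ x.length) ≤ q.eval x.length *
        (univ.filter (fun r : Fin (ℓ x.length) → Bool => f (boolPair x (List.ofFn r)) ∈ L₂)).card)
    (h₂ : L₂ ∈ BPP) : L₁ ∈ BPP := by
  -- the query generator and the verdict
  obtain ⟨Qg, hQg, hQval⟩ := stub_orQueryFP f hf ℓp
  set D : Language Bool := {z : List Bool | n₀ ≤ (fstF (fstF z)).length ∧ true ∈ sndF z} with hD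
  have hDP : D ∈ Classes.P := stub_orVerdictP n₀
  have hmemD : ∀ z : List Bool, z ∈ D ↔ n₀ ≤ (fstF (fstF z)).length ∧ true ∈ sndF z :=
    fun z => Iff.rfl
  -- the OR-language `L₃` and its membership in `BPP`
  set L₃ : Language Bool := AdQuery.adLang Qg (2 * q) D L₂ with hL₃
  have hL₃BPP : L₃ ∈ BPP := AdBPPSim.adLang_mem_BPP h₂ hQg (2 * q) hDP
  -- the queries on `w = ⟨x, R⟩`
  let Qfun : List Bool → List Bool → ℕ → List Bool := fun x R i =>
    f (boolPair x ((R.drop (i * ℓ x.length)).take (ℓ x.length)))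
  have hQfun : ∀ x R acc : List Bool, Qg (boolPair (boolPair x R) acc) = Qfun x R acc.length := by
    intro x R acc
    simp only [Qfun, hQval, hℓ]
  have hmemL₃ : ∀ x R : List Bool, boolPair x R ∈ L₃ ↔
      n₀ ≤ x.length ∧ ∃ i < (2 * q).eval (boolPair x R).length, Qfun x R i ∈ L₂ := by
    intro x R
    rw [hL₃, AdQuery.mem_adLang_iff, hmemD, fstF_boolPair, sndF_boolPair, fstF_boolPair,
      true_mem_adBits_iff (Qfun x R) (hQfun x R)]
  -- the guarded language
  set L₁' : Language Bool := {x : List Bool | x ∈ L₁ ∧ n₀ ≤ x.length} with hL₁'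
  -- the block sampler as a randomized reduction `L₁' ≤ᵣ L₃`
  have hred : PolyTimeRandReducible' L₁' L₃ := by
    refine ⟨⟨fun x R => boolPair x R, fun n => (2 * q * ℓp).eval n⟩,
      AdBPPSim.isPolyTime_of_FP (F := id) OracleCompose.id_mem_FP (2 * q * ℓp) (fun x r => rfl),
      ⟨2 * q * ℓp, fun n => rfl⟩, fun x => ?_⟩
    rw [RandAlg.pr_eq_uniformProb]
    change 2 / 3 ≤ uniformProb ((2 * q * ℓp).eval x.length)
      {R : List Bool | boolPair x R ∈ L₃ ↔ x ∈ L₁'}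
    have hcoins : (2 * q * ℓp).eval x.length = 2 * q.eval x.length * ℓ x.length := by
      simp [hℓ]
    rw [hcoins]
    by_cases hx : x ∈ L₁'
    · -- YES-instance: some fresh block hits with probability ≥ 3/4
      obtain ⟨hxL, hxn⟩ := hx
      set n := x.length with hn
      set G : Set (List Bool) := {r : List Bool | f (boolPair x r) ∈ L₂} with hG
      have hq1 : 1 ≤ q.eval n := by
        by_contra hq0
        have h0 : q.eval n = 0 := by omega
        have h := hYES x hxL hxn
        rw [h0, zero_mul] at h
        exact absurd h (not_le.2 (by positivity))
      -- density of the good seeds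
      have hdens : 1 / ((q.eval n : ℕ) : ℝ) ≤ uniformProb (ℓ n) G := by
        have h := hYES x hxL hxn
        rw [uniformProb_eq_card_fun, hG]
        have hq0 : (0 : ℝ) < ((q.eval n : ℕ) : ℝ) := by exact_mod_cast hq1
        rw [div_le_div_iff₀ hq0 (by positivity), one_mul]
        have h' : (((2 : ℕ) ^ (ℓ n) : ℕ) : ℝ) ≤ ((q.eval n : ℕ) : ℝ) *
            ((univ.filter (fun r : Fin (ℓ n) → Bool => f (boolPair x (List.ofFn r)) ∈ L₂)).card : ℝ) := by
          exact_mod_cast h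
        push_cast at h'
        simpa [Set.mem_setOf_eq, mul_comm] using h'
      -- the miss event and its probability
      have hmiss : uniformProb (2 * q.eval n * ℓ n)
          {R : List Bool | ∀ j < 2 * q.eval n, (R.drop (j * ℓ n)).take (ℓ n) ∉ G} ≤ 1 / 4 := by
        rw [stub_blockMissProb]
        calc (1 - uniformProb (ℓ n) G) ^ (2 * q.eval n)
            ≤ (1 - 1 / ((q.eval n : ℕ) : ℝ)) ^ (2 * q.eval n) := by
              apply pow_le_pow_left₀
              · linarith [uniformProb_le_one (ℓ n) G]
              · linarith
          _ ≤ 1 / 4 := stub_expQuarter (q.eval n) hq1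
      -- a hit forces membership in `L₃`
      have hsub : ∀ R : List Bool,
          R ∈ ({R : List Bool | ∀ j < 2 * q.eval n, (R.drop (j * ℓ n)).take (ℓ n) ∉ G}ᶜ :
            Set (List Bool)) →
          R ∈ {R : List Bool | boolPair x R ∈ L₃ ↔ x ∈ L₁'} := by
        intro R hgood
        simp only [Set.mem_compl_iff, Set.mem_setOf_eq, not_forall, not_not, exists_prop] at hgood
        obtain ⟨j, hj, hjG⟩ := hgood
        simp only [Set.mem_setOf_eq]
        refine ⟨fun _ => ⟨hxL, hxn⟩, fun _ => ?_⟩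
        rw [hmemL₃]
        refine ⟨hxn, j, lt_of_lt_of_le hj ?_, hjG⟩
        have hlen : n ≤ (boolPair x R).length := by
          rw [length_boolPair]; omega
        have := TM2Iter.eval_mono q hlen
        simp only [eval_mul, eval_ofNat]
        omega
      have hle : uniformProb (2 * q.eval n * ℓ n)
          ({R : List Bool | ∀ j < 2 * q.eval n, (R.drop (j * ℓ n)).take (ℓ n) ∉ G}ᶜ) ≤
          uniformProb (2 * q.eval n * ℓ n) {R : List Bool | boolPair x R ∈ L₃ ↔ x ∈ L₁'} :=
        BPExp.uniformProb_mono_len fun R hR _ => hsub R hR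
      rw [uniformProb_compl] at hle
      linarith
    · -- NO-instance: the verdict is correct for every coin string
      have hall : ∀ R : List Bool, R ∈ {R : List Bool | boolPair x R ∈ L₃ ↔ x ∈ L₁'} := by
        intro R
        simp only [Set.mem_setOf_eq]
        refine ⟨fun h => ?_, fun h => absurd h hx⟩
        exfalso
        rw [hmemL₃] at h
        obtain ⟨hxn, i, -, hi⟩ := h
        have hxL : x ∉ L₁ := fun h' => hx ⟨h', hxn⟩
        exact hNO x hxL _ hi
      have h1 : uniformProb (2 * q.eval x.length * ℓ x.length) (Set.univ : Set (List Bool)) ≤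
          uniformProb (2 * q.eval x.length * ℓ x.length)
            {R : List Bool | boolPair x R ∈ L₃ ↔ x ∈ L₁'} :=
        BPExp.uniformProb_mono_len fun R _ _ => hall R
      rw [uniformProb_univ] at h1
      linarith
  have hL₁' : L₁' ∈ BPP := mem_BPP_of_polyTimeRandReducible'_holds hred hL₃BPP
  -- splice the short inputs
  exact mem_BPP_of_eqOn_le hL₁' n₀ fun x hx => ⟨fun h => ⟨h, hx⟩, fun h => h.1⟩

/-- **STUB R · `stub_rurClosureBPP`** of the line `Sketch` (skeleton v3) for the crux
`ArithStatLadder.IqThreeNotBPP` — the registered signature, discharged by `mem_BPP_of_rurReduction`.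
[cite: AroraBarakCC2009, §7.6 and §7.4.1] -/
theorem stub_rurClosureBPP :
    ∀ (L₁ L₂ : Language Bool) (f : List Bool → List Bool), f ∈ FP →
      ∀ (ℓ : ℕ → ℕ) (ℓp q : Polynomial ℕ) (n₀ : ℕ), (∀ n, ℓ n = ℓp.eval n) →
        (∀ x : List Bool, x ∉ L₁ → ∀ r : List Bool, f (boolPair x r) ∉ L₂) →
        (∀ x : List Bool, x ∈ L₁ → n₀ ≤ x.length →
          2 ^ (ℓ x.length) ≤ q.eval x.length *
            (univ.filter (fun r : Fin (ℓ x.length) → Bool =>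
              f (boolPair x (List.ofFn r)) ∈ L₂)).card) →
        L₂ ∈ BPP → L₁ ∈ BPP :=
  fun L₁ L₂ f hf ℓ ℓp q n₀ hℓ hNO hYES h₂ =>
    mem_BPP_of_rurReduction L₁ L₂ f hf ℓ ℓp q n₀ hℓ hNO hYES h₂

end Summit.QuantumAdvantage.QuantumAdvantage.Theorems.IqThreeNotBPP

end
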